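import Mathlib.Analysis.SpecialFunctions.Gaussian.FourierTransform
import Mathlib.Analysis.SpecialFunctions.Integrals.Basic
import Mathlib.MeasureTheory.Integral.Prod
import Mathlib.MeasureTheory.Integral.DominatedConvergence
import Mathlib.Analysis.SpecialFunctions.ImproperIntegrals
import HarnessLib

/-!
# The Gaussian filter of Hastings–Koma / Nachtergaele–Sims (analytic lemmas)

Sibling proof file of `Literature/MathematicalPhysics/QuantumLattice/LiebRobinson.lean`, first of the
files discharging the named fact `hastings_koma` (exponential clustering of gapped ground states,
Hastings–Koma CMP **265** (2006) Thm. 8 / Nachtergaele–Sims CMP **265** (2006) Thm. 2). This file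
contains **theorems only** and no matrices: it is the real/complex analysis of the "filter function"
step of the printed proofs, isolated from the operator algebra.

## Content (HK06 §3, Lemma 14 = NS06 §3.2, Lemma 1, in finite-truncation form)

The printed proofs extract the "negative-frequency part" of the time-dependent correlation
`t ↦ ⟨Ω, [A, τ_t(B)] Ω⟩` with the kernel `lim_{T→∞} lim_{ε↓0} (i/2π) e^{-αt²}/(t + iε)` on `[-T, T]`,
i.e. `δ(t)/2 + (i/2π) PV e^{-αt²}/t`, whose Fourier transform is a Gaussian-smoothed Heaviside
function (HK06 Lemma 14: `= 1 + O(e^{-ΔE²/4α})` for energies `E ≥ ΔE`, `O(e^{-ΔE²/4α})` for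
`E ≤ -ΔE`). We formalise exactly this mechanism, with the principal value written out by hand:

* `integral_cos_mul_gaussian`: `∫ cos(st) e^{-αt²} dt = √(π/α) e^{-s²/4α}` (Mathlib's
  `integral_cexp_quadratic`, real part);
* `integral_sinc_gaussian_eq`: `∫ (∫₀^Δ cos(st) ds) e^{-αt²} dt = √(π/α) ∫₀^Δ e^{-s²/4α} ds`
  (Fubini; `∫₀^Δ cos(st) ds = sin(Δt)/t` is the PV kernel applied to the mode `e^{itΔ}`);
* `gaussian_tail_bounds`: `0 ≤ π - √(π/α)∫₀^Δ e^{-s²/4α} ≤ 2π e^{-Δ²/4α}` for `Δ ≥ 0` (HK06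
  Lemma 14, the two cases, with the harmless constant `2`);
* `abstract_clustering_bound`: the **assembly of HK06 §3 / NS06 §3.2 for a finite spectral
  resolution**. Given modes `Δᵢ ≥ 0` with `Δ_{i₀} = 0` and `Δᵢ ≥ γ` otherwise (the gap), weights
  `aᵢ, bᵢ` (the matrix elements `⟨Ω,Aψᵢ⟩⟨ψᵢ,BΩ⟩`, `⟨Ω,Bψᵢ⟩⟨ψᵢ,AΩ⟩`) with `a_{i₀} = b_{i₀}` and
  `Σ|aᵢ|, Σ|bᵢ| ≤ K`, and the function `h(t) = Σᵢ (aᵢe^{itΔᵢ} - bᵢe^{-itΔᵢ})`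
  (`= ⟨Ω,[A,τ_t(B)]Ω⟩`) obeying a Lipschitz bound at `0`, a Lieb–Robinson-type bound
  `|h(t)| ≤ c₂e^{κ|t|}` and a trivial bound `|h| ≤ c₃`, the "connected correlation"
  `Σ_{i ≠ i₀} aᵢ` (`= ⟨AB⟩ - ⟨A⟩⟨B⟩`) is bounded by
  `|h(0)|/2 + 2K e^{-γ²/4α} + (c₁t₁/2 + c₂e^{κT}T/t₁ + c₃e^{-αT²}/(αT²))/π`
  for any `0 < t₁ ≤ T` — the three last terms being the time integral split at `t₁` and `T`
  exactly as in the proof of HK06 Thm. 8 (the split `|t| ≤ cℓ`, `|t| > cℓ`) / NS06 §3.2.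

Deviations from print: the limits `T → ∞`, `ε ↓ 0` are replaced by finite bookkeeping; the
Lieb–Robinson input is used without the factor `(e^{v|t|} - 1)`, so the `1/t` singularity at `0`
is controlled by the separate Lipschitz hypothesis (split at `t₁`); the Gaussian tail is bounded by
`2π e^{-Δ²/4α}` instead of `(π) e^{-Δ²/4α}`.

## Sources

* M. B. Hastings, T. Koma, *Spectral gap and exponential decay of correlations*, CMP **265** (2006)
  781–804, §3 and Lemma 14 (arXiv:math-ph/0507008, pp. 6–7). [HastingsKomaCMP2006]
* B. Nachtergaele, R. Sims, *Lieb–Robinson bounds and the exponential clustering theorem*, CMP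
  **265** (2006) 119–130, §3.2 and Lemma 1 (arXiv:math-ph/0506030, pp. 6–8). [NachtergaeleSimsCMP2006]

Mathlib: `integral_cexp_quadratic`, `integral_gaussian(_Ioi)`, `intervalIntegral_integral_swap`,
`integral_comp_abs`, `integral_exp_mul_Ioi`, `intervalIntegral.norm_integral_le_of_norm_le_const`.
-/

noncomputable section

open Real MeasureTheory Set Complex Finset

namespace Literature.MathematicalPhysics.QuantumLattice

/-! ### Gaussian integrals -/

/-- `√(π/α) · √(π/(1/(4α))) = 2π` (bookkeeping of the two Gaussian normalisations). [folklore] -/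
theorem sqrt_pi_div_mul_sqrt (α : ℝ) (hα : 0 < α) : √(π / α) * √(π / (1 / (4 * α))) = 2 * π := by
  rw [← Real.sqrt_mul (by positivity)]
  have : π / α * (π / (1 / (4 * α))) = (2 * π) ^ 2 := by field_simp; ring
  rw [this, Real.sqrt_sq (by positivity)]

/-- **The cosine transform of a Gaussian**: `∫ cos(st) e^{-αt²} dt = √(π/α) e^{-s²/(4α)}` (real part
of Mathlib's `integral_cexp_quadratic`). HK06 Lemma 14, proof, eq. "Using the Fourier
transformation, `e^{-iEt}e^{-αt²} = (1/2π)√(π/α)∫ exp[-(ω+E)²/4α] e^{iωt} dω`". [folklore] -/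
theorem integral_cos_mul_gaussian {α : ℝ} (hα : 0 < α) (s : ℝ) :
    ∫ t : ℝ, Real.cos (s * t) * Real.exp (-α * t ^ 2) = √(π / α) * Real.exp (-s ^ 2 / (4 * α)) := by
  have hb : (-(α : ℂ)).re < 0 := by simp [hα]
  have key := integral_cexp_quadratic hb (s * I) 0
  have hint := integrable_cexp_quadratic' hb (s * I) 0
  have hre : ∀ x : ℝ, (cexp (-(α:ℂ) * (x : ℂ) ^ 2 + (s : ℂ) * I * x + 0)).re =
      Real.cos (s * x) * Real.exp (-α * x ^ 2) := by
    intro x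
    have : -(α:ℂ) * (x : ℂ) ^ 2 + (s : ℂ) * I * x + 0 = ((-α * x ^ 2 : ℝ) : ℂ) + ((s * x : ℝ) : ℂ) * I := by
      push_cast; ring
    rw [this, Complex.exp_re]
    simp only [Complex.add_re, Complex.add_im, Complex.ofReal_re, Complex.ofReal_im, Complex.mul_re,
      Complex.mul_im, Complex.I_re, Complex.I_im, mul_zero, mul_one, sub_zero, zero_add, add_zero]
    ring
  have h1 := integral_re hint
  simp only [RCLike.re_to_complex, hre] at h1
  rw [h1, key]
  have h2 : (↑π / - -(α:ℂ)) ^ (1 / 2 : ℂ) = ((√(π / α) : ℝ) : ℂ) := by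
    rw [neg_neg, Real.sqrt_eq_rpow, Complex.ofReal_cpow (by positivity)]
    push_cast
    rfl
  have h3 : cexp (0 - ((s : ℂ) * I) ^ 2 / (4 * -(α:ℂ))) = ((Real.exp (-s ^ 2 / (4 * α)) : ℝ) : ℂ) := by
    rw [Complex.ofReal_exp]
    congr 1
    push_cast
    field_simp
    ring_nf
    simp [Complex.I_sq]
  rw [h2, h3, ← Complex.ofReal_mul, Complex.ofReal_re]

/-- **Fubini step of the filter**: `∫ (∫₀^Δ cos(st) ds) e^{-αt²} dt = √(π/α) ∫₀^Δ e^{-s²/4α} ds`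
for `Δ ≥ 0` (the inner integral is `sin(Δt)/t`, the principal-value kernel applied to one
spectral mode). HK06 Lemma 14 (the Gaussian-smoothed Heaviside function as the Fourier transform of
the kernel); NS06 Lemma 1. [cite: HastingsKomaCMP2006, Lemma 14] -/
theorem integral_sinc_gaussian_eq {α : ℝ} (hα : 0 < α) {Δ : ℝ} (hΔ : 0 ≤ Δ) :
    ∫ t : ℝ, (∫ s in (0:ℝ)..Δ, Real.cos (s * t)) * Real.exp (-α * t ^ 2) =
      √(π / α) * ∫ s in (0:ℝ)..Δ, Real.exp (-s ^ 2 / (4 * α)) := by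
  have hint : Integrable (Function.uncurry fun (s t : ℝ) => Real.cos (s * t) * Real.exp (-α * t ^ 2))
      ((volume.restrict (Set.uIoc 0 Δ)).prod volume) := by
    rw [Set.uIoc_of_le hΔ]
    have hg : Integrable (fun z : ℝ × ℝ => (1 : ℝ) * Real.exp (-α * z.2 ^ 2))
        ((volume.restrict (Set.Ioc 0 Δ)).prod volume) :=
      (integrable_const (1 : ℝ)).mul_prod (integrable_exp_neg_mul_sq hα)
    refine hg.mono' ?_ (Filter.Eventually.of_forall fun z => ?_)
    · exact Continuous.aestronglyMeasurable (by fun_prop)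
    · obtain ⟨s, t⟩ := z
      simp only [Function.uncurry_apply_pair]
      rw [Real.norm_eq_abs, abs_mul, Real.abs_exp, one_mul]
      exact mul_le_of_le_one_left (Real.exp_pos _).le (Real.abs_cos_le_one _)
  have hswap := intervalIntegral_integral_swap hint
  simp_rw [← intervalIntegral.integral_mul_const]
  rw [← hswap]
  simp_rw [integral_cos_mul_gaussian hα, intervalIntegral.integral_const_mul]

/-- **HK06 Lemma 14, the two estimates**: for `Δ ≥ 0`,
`0 ≤ π - √(π/α) ∫₀^Δ e^{-s²/4α} ds ≤ 2π e^{-Δ²/(4α)}` (the complement is the Gaussian tail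
`√(π/α)∫_Δ^∞ e^{-s²/4α} ds`, bounded by completing `s² ≥ Δ² + (s-Δ)²`; the printed constant is `π`).
[cite: HastingsKomaCMP2006, Lemma 14] -/
theorem gaussian_tail_bounds {α : ℝ} (hα : 0 < α) {Δ : ℝ} (hΔ : 0 ≤ Δ) :
    0 ≤ π - √(π / α) * ∫ s in (0:ℝ)..Δ, Real.exp (-s ^ 2 / (4 * α)) ∧
    π - √(π / α) * ∫ s in (0:ℝ)..Δ, Real.exp (-s ^ 2 / (4 * α)) ≤
      2 * π * Real.exp (-Δ ^ 2 / (4 * α)) := by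
  set g : ℝ → ℝ := fun s => Real.exp (-s ^ 2 / (4 * α)) with hg
  have hb : 0 < 1 / (4 * α) := by positivity
  have hg' : g = fun s => Real.exp (-(1 / (4 * α)) * s ^ 2) := by
    funext s; simp only [hg]; congr 1; field_simp
  have hg_int : Integrable g := by rw [hg']; exact integrable_exp_neg_mul_sq hb
  have hIoi0 : √(π / α) * ∫ s in Ioi 0, g s = π := by
    rw [hg', integral_gaussian_Ioi (1 / (4 * α)), ← mul_div_assoc, sqrt_pi_div_mul_sqrt α hα]
    ring
  have hsplit : ∫ s in Ioi 0, g s = (∫ s in (0:ℝ)..Δ, g s) + ∫ s in Ioi Δ, g s := by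
    rw [intervalIntegral.integral_of_le hΔ, ← setIntegral_union (Set.Ioc_disjoint_Ioi_same)
      measurableSet_Ioi hg_int.integrableOn hg_int.integrableOn, Set.Ioc_union_Ioi_eq_Ioi hΔ]
  have key : π - √(π / α) * ∫ s in (0:ℝ)..Δ, g s = √(π / α) * ∫ s in Ioi Δ, g s := by
    have h := hIoi0
    rw [hsplit, mul_add] at h
    linarith
  have htail_nonneg : 0 ≤ ∫ s in Ioi Δ, g s :=
    setIntegral_nonneg measurableSet_Ioi fun s _ => (Real.exp_pos _).le
  have hshift_int : Integrable fun s : ℝ => Real.exp (-Δ ^ 2 / (4 * α)) * g (s - Δ) :=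
    (hg_int.comp_sub_right Δ).const_mul _
  have htail_le : ∫ s in Ioi Δ, g s ≤ Real.exp (-Δ ^ 2 / (4 * α)) * (2 * √(π / (1 / (4 * α))) / 2) := by
    calc ∫ s in Ioi Δ, g s ≤ ∫ s in Ioi Δ, Real.exp (-Δ ^ 2 / (4 * α)) * g (s - Δ) := by
          refine setIntegral_mono_on hg_int.integrableOn hshift_int.integrableOn measurableSet_Ioi
            fun s hs => ?_
          simp only [hg, ← Real.exp_add]
          refine Real.exp_le_exp.2 ?_
          rw [← add_div, div_le_div_iff_of_pos_right (by positivity)]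
          have hs' : Δ ≤ s := le_of_lt hs
          nlinarith
      _ ≤ ∫ s, Real.exp (-Δ ^ 2 / (4 * α)) * g (s - Δ) :=
          setIntegral_le_integral hshift_int (Filter.Eventually.of_forall fun s => by
            simp only [Pi.zero_apply, hg]; positivity)
      _ = Real.exp (-Δ ^ 2 / (4 * α)) * ∫ s, g s := by
          rw [integral_const_mul]
          congr 1
          exact integral_sub_right_eq_self g Δ
      _ = Real.exp (-Δ ^ 2 / (4 * α)) * (2 * √(π / (1 / (4 * α))) / 2) := by
          rw [hg', integral_gaussian]; ring
  have h2 : √(π / α) * ∫ s in Ioi Δ, g s ≤ 2 * π * Real.exp (-Δ ^ 2 / (4 * α)) := by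
    calc √(π / α) * ∫ s in Ioi Δ, g s
        ≤ √(π / α) * (Real.exp (-Δ ^ 2 / (4 * α)) * (2 * √(π / (1 / (4 * α))) / 2)) :=
          mul_le_mul_of_nonneg_left htail_le (Real.sqrt_nonneg _)
      _ = (√(π / α) * √(π / (1 / (4 * α)))) * Real.exp (-Δ ^ 2 / (4 * α)) := by ring
      _ = 2 * π * Real.exp (-Δ ^ 2 / (4 * α)) := by rw [sqrt_pi_div_mul_sqrt α hα]
  rw [key]
  exact ⟨mul_nonneg (Real.sqrt_nonneg _) htail_nonneg, h2⟩

/-! ### The principal-value kernel on one mode -/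

/-- The principal-value kernel on one mode: `∫₀^Δ cos(st) ds = sin(Δt)/t` for `t ≠ 0`.
NS06 §3.2 (the kernel `e^{-αt²}/t` against `e^{itΔ}`). [folklore] -/
theorem intervalIntegral_cos_mul_eq_sin_div (Δ : ℝ) {t : ℝ} (ht : t ≠ 0) :
    ∫ s in (0:ℝ)..Δ, Real.cos (s * t) = Real.sin (Δ * t) / t := by
  rw [intervalIntegral.integral_comp_mul_right (fun u => Real.cos u) ht, integral_cos]
  simp [smul_eq_mul, div_eq_inv_mul]

/-- `|∫₀^Δ cos(st) ds| ≤ |Δ|`. [folklore] -/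
theorem abs_intervalIntegral_cos_mul_le (Δ t : ℝ) :
    |∫ s in (0:ℝ)..Δ, Real.cos (s * t)| ≤ |Δ| := by
  have h := intervalIntegral.norm_integral_le_of_norm_le_const (a := 0) (b := Δ) (C := 1)
    (f := fun s => Real.cos (s * t)) fun s _ => by
      rw [Real.norm_eq_abs]; exact Real.abs_cos_le_one _
  simpa using h

/-- `t ↦ ∫₀^Δ cos(st) ds` is continuous (a parametric interval integral of a continuous
integrand). [folklore] -/
theorem continuous_intervalIntegral_cos_mul (Δ : ℝ) :
    Continuous fun t : ℝ => ∫ s in (0:ℝ)..Δ, Real.cos (s * t) :=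
  intervalIntegral.continuous_parametric_intervalIntegral_of_continuous'
    (f := fun t s => Real.cos (s * t)) (by fun_prop) 0 Δ

/-- `t ↦ ∫₀^Δ cos(st) ds` is even. [folklore] -/
theorem intervalIntegral_cos_mul_neg (Δ t : ℝ) :
    ∫ s in (0:ℝ)..Δ, Real.cos (s * -t) = ∫ s in (0:ℝ)..Δ, Real.cos (s * t) := by
  simp [mul_neg, Real.cos_neg]

/-- One filtered mode `(∫₀^Δ cos(st) ds) e^{-αt²}` is integrable in `t` (bounded by
`|Δ| e^{-αt²}`). [folklore] -/
theorem integrable_sinc_gaussian {α : ℝ} (hα : 0 < α) (Δ : ℝ) :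
    Integrable fun t : ℝ => (∫ s in (0:ℝ)..Δ, Real.cos (s * t)) * Real.exp (-α * t ^ 2) := by
  refine ((integrable_exp_neg_mul_sq hα).const_mul |Δ|).mono' ?_ (Filter.Eventually.of_forall fun t => ?_)
  · exact ((continuous_intervalIntegral_cos_mul Δ).mul (by fun_prop)).aestronglyMeasurable
  · rw [Real.norm_eq_abs, abs_mul, Real.abs_exp]
    exact mul_le_mul_of_nonneg_right (abs_intervalIntegral_cos_mul_le Δ t) (Real.exp_pos _).le

/-- `e^{ix} - e^{-ix} = 2 sin(x) i`. [folklore] -/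
theorem exp_mul_I_sub_exp_neg_mul_I (x : ℝ) :
    cexp ((x : ℂ) * I) - cexp (-(x : ℂ) * I) = 2 * Real.sin x * I := by
  rw [← Complex.cos_add_sin_I, ← Complex.cos_sub_sin_I, ← Complex.ofReal_sin]
  ring

/-! ### Assembly -/

/-- **The filter-function step of the exponential clustering theorem, for a finite spectral
resolution** (HK06 §3, proof of Thm. 8, with Lemma 14; NS06 §3.2 with Lemma 1).
Data: modes `Δᵢ` with `Δ_{i₀} = 0` and `Δᵢ ≥ γ > 0` for `i ≠ i₀` (the gap), weights `aᵢ, bᵢ ∈ ℂ` with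
`a_{i₀} = b_{i₀}` (the ground-state terms `⟨A⟩⟨B⟩` of both orderings agree) and `Σ‖aᵢ‖, Σ‖bᵢ‖ ≤ K`,
and `h(t) = Σᵢ (aᵢ e^{itΔᵢ} - bᵢ e^{-itΔᵢ})` (the commutator expectation `⟨Ω,[A,τ_t(B)]Ω⟩` in the
application) with `‖h(t) - h(-t)‖ ≤ c₁ t` (`t > 0`), `‖h(t)‖ ≤ c₂ e^{κ|t|}` (Lieb–Robinson) and
`‖h(t)‖ ≤ c₃`. Then for all `0 < t₁ ≤ T`, `α > 0`:
`‖Σ_{i≠i₀} aᵢ‖ ≤ ‖h(0)‖/2 + 2K e^{-γ²/(4α)} + (c₁t₁/2 + c₂e^{κT}T/t₁ + c₃e^{-αT²}/(αT²))/π`.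
Proof: with `Pᵢ = √(π/α)∫₀^{Δᵢ} e^{-s²/4α}` (`P_{i₀} = 0`, `|π - Pᵢ| ≤ 2πe^{-γ²/4α}` otherwise,
`gaussian_tail_bounds`) and `F(t) = Σᵢ (aᵢ+bᵢ)(∫₀^{Δᵢ}cos(st)ds) e^{-αt²}` one has the identity
`π Σ_{i≠i₀} aᵢ = (π/2) h(0) + ½∫F + ½Σ_{i≠i₀}(π - Pᵢ)(aᵢ+bᵢ)` (`integral_sinc_gaussian_eq`), and
`‖F(t)‖ = ‖h(t)-h(-t)‖ e^{-αt²}/(2t)` for `t > 0`, whose integral over `(0,t₁] ∪ (t₁,T] ∪ (T,∞)` is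
bounded piecewise. [cite: HastingsKomaCMP2006, §3, Lemma 14 and proof of Theorem 8] -/
theorem abstract_clustering_bound {ι : Type*} [Fintype ι] [DecidableEq ι] (i₀ : ι) (Δ : ι → ℝ)
    (a b : ι → ℂ) (h : ℝ → ℂ) {γ α K c₁ c₂ c₃ κ t₁ T : ℝ}
    (hγ : 0 < γ) (hα : 0 < α) (ht₁ : 0 < t₁) (hT : t₁ ≤ T) (hκ : 0 ≤ κ)
    (hΔ₀ : Δ i₀ = 0) (hΔ : ∀ i, i ≠ i₀ → γ ≤ Δ i)
    (hab : a i₀ = b i₀) (ha : ∑ i, ‖a i‖ ≤ K) (hb : ∑ i, ‖b i‖ ≤ K)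
    (hh : ∀ t : ℝ, h t = ∑ i, (a i * cexp ((t * Δ i : ℝ) * I) - b i * cexp (-(t * Δ i : ℝ) * I)))
    (hL1 : ∀ t : ℝ, 0 < t → ‖h t - h (-t)‖ ≤ c₁ * t)
    (hL2 : ∀ t : ℝ, ‖h t‖ ≤ c₂ * Real.exp (κ * |t|))
    (hL3 : ∀ t : ℝ, ‖h t‖ ≤ c₃) :
    ‖∑ i ∈ univ.erase i₀, a i‖ ≤
      ‖h 0‖ / 2 + 2 * K * Real.exp (-γ ^ 2 / (4 * α)) +
        (c₁ * t₁ / 2 + c₂ * Real.exp (κ * T) * T / t₁ +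
          c₃ * Real.exp (-α * T ^ 2) / (α * T ^ 2)) / π := by
  -- nonnegativity of the constants
  have hc₁ : 0 ≤ c₁ := by
    have h1 := hL1 1 one_pos
    rw [mul_one] at h1
    exact (norm_nonneg _).trans h1
  have hc₂ : 0 ≤ c₂ := by
    have h2 := hL2 0
    rw [abs_zero, mul_zero, Real.exp_zero, mul_one] at h2
    exact (norm_nonneg _).trans h2
  have hc₃ : 0 ≤ c₃ := (norm_nonneg _).trans (hL3 0)
  have hT0 : 0 < T := ht₁.trans_le hT
  have hΔnn : ∀ i, 0 ≤ Δ i := fun i => by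
    by_cases hi : i = i₀
    · rw [hi, hΔ₀]
    · exact hγ.le.trans (hΔ i hi)
  -- the kernel values `P i = √(π/α) ∫_0^{Δ i} e^{-s²/4α} ∈ [π - 2π e^{-Δᵢ²/4α}, π]`, `P i₀ = 0`
  set P : ι → ℝ := fun i => √(π / α) * ∫ s in (0:ℝ)..Δ i, Real.exp (-s ^ 2 / (4 * α)) with hP
  have hP₀ : P i₀ = 0 := by simp [hP, hΔ₀]
  have hPbd : ∀ i, i ≠ i₀ → |π - P i| ≤ 2 * π * Real.exp (-γ ^ 2 / (4 * α)) := by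
    intro i hi
    obtain ⟨h1, h2⟩ := gaussian_tail_bounds hα (hΔnn i)
    rw [abs_of_nonneg h1]
    refine h2.trans (mul_le_mul_of_nonneg_left (Real.exp_le_exp.2 ?_) (by positivity))
    rw [neg_div, neg_div, neg_le_neg_iff]
    refine div_le_div_of_nonneg_right ?_ (by positivity)
    have := hΔ i hi
    nlinarith
  -- one mode of the integrand and its integral
  have hFint_i : ∀ i, Integrable fun t : ℝ => (a i + b i) *
      (((∫ s in (0:ℝ)..Δ i, Real.cos (s * t)) * Real.exp (-α * t ^ 2) : ℝ) : ℂ) :=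
    fun i => ((integrable_sinc_gaussian hα (Δ i)).ofReal).const_mul _
  -- the integrand `F`
  set F : ℝ → ℂ := fun t => ∑ i, (a i + b i) *
      (((∫ s in (0:ℝ)..Δ i, Real.cos (s * t)) * Real.exp (-α * t ^ 2) : ℝ) : ℂ) with hF
  have hFint : Integrable F := integrable_finsetSum _ fun i _ => hFint_i i
  have hintF : ∫ t, F t = ∑ i, (a i + b i) * (P i : ℂ) := by
    rw [hF, integral_finsetSum _ fun i _ => hFint_i i]
    refine Finset.sum_congr rfl fun i _ => ?_
    rw [integral_const_mul, integral_complex_ofReal, integral_sinc_gaussian_eq hα (hΔnn i)]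
  -- `h t - h (-t) = 2 I Σ (aᵢ + bᵢ) sin(t Δᵢ)`
  have hdiff : ∀ t : ℝ, h t - h (-t) = 2 * I * ∑ i, (a i + b i) * (Real.sin (Δ i * t) : ℂ) := by
    intro t
    rw [hh t, hh (-t), ← Finset.sum_sub_distrib, Finset.mul_sum]
    refine Finset.sum_congr rfl fun i _ => ?_
    have e1 : ((-t * Δ i : ℝ) : ℂ) = -((t * Δ i : ℝ) : ℂ) := by push_cast; ring
    rw [e1, neg_neg, mul_comm (Δ i) t]
    have key := exp_mul_I_sub_exp_neg_mul_I (t * Δ i)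
    linear_combination (a i + b i) * key
  -- norm of `F` away from `0`
  have hFnorm : ∀ t : ℝ, 0 < t →
      ‖F t‖ = ‖h t - h (-t)‖ / (2 * t) * Real.exp (-α * t ^ 2) := by
    intro t ht
    have hS : F t = (t : ℂ)⁻¹ * (∑ i, (a i + b i) * (Real.sin (Δ i * t) : ℂ)) *
        (Real.exp (-α * t ^ 2) : ℂ) := by
      simp only [hF, Finset.mul_sum, Finset.sum_mul]
      refine Finset.sum_congr rfl fun i _ => ?_
      rw [intervalIntegral_cos_mul_eq_sin_div (Δ i) ht.ne']
      push_cast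
      field_simp
    have hD : ∑ i, (a i + b i) * (Real.sin (Δ i * t) : ℂ) = (2 * I)⁻¹ * (h t - h (-t)) := by
      rw [hdiff t, ← mul_assoc, inv_mul_cancel₀ (by simp), one_mul]
    rw [hS, hD]
    simp only [norm_mul, norm_inv, Complex.norm_real, Real.norm_eq_abs, abs_of_pos ht,
      Complex.norm_ofNat, Complex.norm_I, mul_one, abs_of_pos (Real.exp_pos _)]
    field_simp
  -- the main identity
  have hid : (π : ℂ) * ∑ i ∈ univ.erase i₀, a i =
      (π / 2 : ℂ) * h 0 + (1 / 2 : ℂ) * (∫ t, F t) +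
        (1 / 2 : ℂ) * ∑ i ∈ univ.erase i₀, ((π - P i : ℝ) : ℂ) * (a i + b i) := by
    have h0 : h 0 = ∑ i ∈ univ.erase i₀, (a i - b i) := by
      rw [hh 0, ← Finset.add_sum_erase _ _ (Finset.mem_univ i₀), hab]
      simp
    have hI : ∫ t, F t = ∑ i ∈ univ.erase i₀, (a i + b i) * (P i : ℂ) := by
      rw [hintF, ← Finset.add_sum_erase _ _ (Finset.mem_univ i₀), hP₀]
      simp
    rw [h0, hI, Finset.mul_sum, Finset.mul_sum, Finset.mul_sum, Finset.mul_sum,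
      ← Finset.sum_add_distrib, ← Finset.sum_add_distrib]
    refine Finset.sum_congr rfl fun i _ => ?_
    push_cast
    ring
  -- bound on the spectral remainder
  have hR : ‖∑ i ∈ univ.erase i₀, ((π - P i : ℝ) : ℂ) * (a i + b i)‖ ≤
      2 * π * Real.exp (-γ ^ 2 / (4 * α)) * (2 * K) := by
    calc ‖∑ i ∈ univ.erase i₀, ((π - P i : ℝ) : ℂ) * (a i + b i)‖
        ≤ ∑ i ∈ univ.erase i₀, ‖((π - P i : ℝ) : ℂ) * (a i + b i)‖ := norm_sum_le _ _
      _ ≤ ∑ i ∈ univ.erase i₀, 2 * π * Real.exp (-γ ^ 2 / (4 * α)) * (‖a i‖ + ‖b i‖) := by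
          refine Finset.sum_le_sum fun i hi => ?_
          rw [norm_mul, Complex.norm_real, Real.norm_eq_abs]
          exact mul_le_mul (hPbd i (Finset.ne_of_mem_erase hi)) (norm_add_le _ _)
            (norm_nonneg _) (by positivity)
      _ = 2 * π * Real.exp (-γ ^ 2 / (4 * α)) *
            (∑ i ∈ univ.erase i₀, ‖a i‖ + ∑ i ∈ univ.erase i₀, ‖b i‖) := by
          rw [← Finset.mul_sum, Finset.sum_add_distrib]
      _ ≤ 2 * π * Real.exp (-γ ^ 2 / (4 * α)) * (2 * K) := by
          refine mul_le_mul_of_nonneg_left ?_ (by positivity)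
          have h1 : ∑ i ∈ univ.erase i₀, ‖a i‖ ≤ ∑ i, ‖a i‖ :=
            Finset.sum_le_sum_of_subset_of_nonneg (Finset.erase_subset _ _)
              fun i _ _ => norm_nonneg _
          have h2 : ∑ i ∈ univ.erase i₀, ‖b i‖ ≤ ∑ i, ‖b i‖ :=
            Finset.sum_le_sum_of_subset_of_nonneg (Finset.erase_subset _ _)
              fun i _ _ => norm_nonneg _
          linarith
  -- bound on the time integral: reduce to `(0, ∞)`
  have hFeven : ∀ t : ℝ, F (-t) = F t := by
    intro t
    simp only [hF, intervalIntegral_cos_mul_neg, neg_sq]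
  have hnormInt : ∫ t, ‖F t‖ = 2 * ∫ t in Ioi 0, ‖F t‖ := by
    rw [← integral_comp_abs (f := fun t => ‖F t‖)]
    refine integral_congr_ae (Filter.Eventually.of_forall fun t => ?_)
    show ‖F t‖ = ‖F |t|‖
    rcases le_total 0 t with ht | ht
    · rw [abs_of_nonneg ht]
    · rw [abs_of_nonpos ht, hFeven]
  have hFnormInt : Integrable fun t => ‖F t‖ := hFint.norm
  -- split `(0, ∞) = (0, T] ∪ (T, ∞)` and `(0, T] = (0, t₁] ∪ (t₁, T]`
  have hsplit : ∫ t in Ioi 0, ‖F t‖ =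
      (∫ t in (0:ℝ)..t₁, ‖F t‖) + (∫ t in t₁..T, ‖F t‖) + ∫ t in Ioi T, ‖F t‖ := by
    rw [intervalIntegral.integral_add_adjacent_intervals hFnormInt.intervalIntegrable
      hFnormInt.intervalIntegrable, intervalIntegral.integral_of_le hT0.le,
      ← setIntegral_union Set.Ioc_disjoint_Ioi_same measurableSet_Ioi hFnormInt.integrableOn
        hFnormInt.integrableOn, Set.Ioc_union_Ioi_eq_Ioi hT0.le]
  -- piece 1: `(0, t₁]`
  have hpiece1 : ∫ t in (0:ℝ)..t₁, ‖F t‖ ≤ c₁ * t₁ / 2 := by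
    have h1 := intervalIntegral.norm_integral_le_of_norm_le_const (a := 0) (b := t₁) (C := c₁ / 2)
      (f := fun t => ‖F t‖) fun t ht => by
        rw [Set.uIoc_of_le ht₁.le] at ht
        have ht0 : 0 < t := ht.1
        rw [norm_norm, hFnorm t ht0]
        calc ‖h t - h (-t)‖ / (2 * t) * Real.exp (-α * t ^ 2)
            ≤ c₁ * t / (2 * t) * 1 := by
              refine mul_le_mul (div_le_div_of_nonneg_right (hL1 t ht.1) (by linarith [ht.1]))
                ?_ (Real.exp_pos _).le (by positivity)
              rw [Real.exp_le_one_iff]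
              nlinarith [sq_nonneg t]
          _ = c₁ / 2 := by
              have := ht.1.ne'
              field_simp
    rw [sub_zero, abs_of_pos ht₁, Real.norm_eq_abs] at h1
    have := le_abs_self (∫ t in (0:ℝ)..t₁, ‖F t‖)
    linarith
  -- piece 2: `(t₁, T]`
  have hpiece2 : ∫ t in t₁..T, ‖F t‖ ≤ c₂ * Real.exp (κ * T) * T / t₁ := by
    have h1 := intervalIntegral.norm_integral_le_of_norm_le_const (a := t₁) (b := T)
      (C := c₂ * Real.exp (κ * T) / t₁) (f := fun t => ‖F t‖) fun t ht => by
        rw [Set.uIoc_of_le hT] at ht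
        have ht0 : 0 < t := ht₁.trans ht.1
        rw [norm_norm, hFnorm t ht0]
        have hh1 : ‖h t - h (-t)‖ ≤ 2 * (c₂ * Real.exp (κ * T)) := by
          calc ‖h t - h (-t)‖ ≤ ‖h t‖ + ‖h (-t)‖ := norm_sub_le _ _
            _ ≤ c₂ * Real.exp (κ * |t|) + c₂ * Real.exp (κ * |-t|) := add_le_add (hL2 t) (hL2 (-t))
            _ = 2 * (c₂ * Real.exp (κ * t)) := by rw [abs_neg, abs_of_pos ht0]; ring
            _ ≤ 2 * (c₂ * Real.exp (κ * T)) := by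
                refine mul_le_mul_of_nonneg_left (mul_le_mul_of_nonneg_left
                  (Real.exp_le_exp.2 (mul_le_mul_of_nonneg_left ht.2 hκ)) hc₂) (by norm_num)
        calc ‖h t - h (-t)‖ / (2 * t) * Real.exp (-α * t ^ 2)
            ≤ 2 * (c₂ * Real.exp (κ * T)) / (2 * t₁) * 1 := by
              refine mul_le_mul ?_ ?_ (Real.exp_pos _).le (by positivity)
              · calc ‖h t - h (-t)‖ / (2 * t) ≤ 2 * (c₂ * Real.exp (κ * T)) / (2 * t) :=
                      div_le_div_of_nonneg_right hh1 (by positivity)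
                  _ ≤ 2 * (c₂ * Real.exp (κ * T)) / (2 * t₁) := by
                      refine div_le_div_of_nonneg_left (by positivity) (by positivity) ?_
                      linarith [ht.1]
              · rw [Real.exp_le_one_iff]
                nlinarith [sq_nonneg t]
          _ = c₂ * Real.exp (κ * T) / t₁ := by field_simp
    rw [abs_of_nonneg (by linarith), Real.norm_eq_abs] at h1
    have h2 := le_abs_self (∫ t in t₁..T, ‖F t‖)
    have h3 : c₂ * Real.exp (κ * T) / t₁ * (T - t₁) ≤ c₂ * Real.exp (κ * T) * T / t₁ := by
      rw [div_mul_eq_mul_div]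
      refine div_le_div_of_nonneg_right ?_ ht₁.le
      nlinarith [mul_nonneg hc₂ (Real.exp_pos (κ * T)).le, ht₁]
    linarith
  -- piece 3: `(T, ∞)`
  have hpiece3 : ∫ t in Ioi T, ‖F t‖ ≤ c₃ * Real.exp (-α * T ^ 2) / (α * T ^ 2) := by
    have hneg : -(α * T) < 0 := by nlinarith [mul_pos hα hT0]
    have hdom : IntegrableOn (fun t : ℝ => c₃ / T * Real.exp (-(α * T) * t)) (Ioi T) :=
      (integrableOn_exp_mul_Ioi hneg T).const_mul _
    calc ∫ t in Ioi T, ‖F t‖ ≤ ∫ t in Ioi T, c₃ / T * Real.exp (-(α * T) * t) := by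
          refine setIntegral_mono_on hFnormInt.integrableOn hdom measurableSet_Ioi fun t ht => ?_
          have hTt : T < t := ht
          have ht0 : 0 < t := hT0.trans hTt
          rw [hFnorm t ht0]
          have hh1 : ‖h t - h (-t)‖ ≤ 2 * c₃ :=
            (norm_sub_le _ _).trans (by linarith [hL3 t, hL3 (-t)])
          calc ‖h t - h (-t)‖ / (2 * t) * Real.exp (-α * t ^ 2)
              ≤ 2 * c₃ / (2 * T) * Real.exp (-(α * T) * t) := by
                refine mul_le_mul ?_ (Real.exp_le_exp.2 ?_) (Real.exp_pos _).le (by positivity)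
                · calc ‖h t - h (-t)‖ / (2 * t) ≤ 2 * c₃ / (2 * t) :=
                        div_le_div_of_nonneg_right hh1 (by positivity)
                    _ ≤ 2 * c₃ / (2 * T) :=
                        div_le_div_of_nonneg_left (by positivity) (by positivity) (by linarith)
                · nlinarith [mul_le_mul_of_nonneg_left hTt.le (mul_pos hα ht0).le]
            _ = c₃ / T * Real.exp (-(α * T) * t) := by field_simp
      _ = c₃ / T * (-Real.exp (-(α * T) * T) / -(α * T)) := by
          rw [integral_const_mul, integral_exp_mul_Ioi hneg T]
      _ = c₃ * Real.exp (-α * T ^ 2) / (α * T ^ 2) := by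
          rw [show -(α * T) * T = -α * T ^ 2 by ring]
          field_simp
  -- assemble
  have hIF : ‖∫ t, F t‖ ≤ 2 * (c₁ * t₁ / 2 + c₂ * Real.exp (κ * T) * T / t₁ +
      c₃ * Real.exp (-α * T ^ 2) / (α * T ^ 2)) := by
    refine (norm_integral_le_integral_norm F).trans ?_
    rw [hnormInt, hsplit]
    linarith
  have hfinal : π * ‖∑ i ∈ univ.erase i₀, a i‖ ≤
      π / 2 * ‖h 0‖ + 1 / 2 * ‖∫ t, F t‖ + 1 / 2 * (2 * π * Real.exp (-γ ^ 2 / (4 * α)) * (2 * K)) := by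
    have := congrArg (fun z : ℂ => ‖z‖) hid
    simp only [norm_mul, Complex.norm_real, Real.norm_eq_abs, abs_of_pos Real.pi_pos] at this
    rw [this]
    refine (norm_add₃_le).trans ?_
    rw [norm_mul, norm_mul, norm_mul]
    have e1 : ‖(π / 2 : ℂ)‖ = π / 2 := by
      rw [show (π / 2 : ℂ) = ((π / 2 : ℝ) : ℂ) by push_cast; ring, Complex.norm_real,
        Real.norm_eq_abs, abs_of_pos (by positivity)]
    have e2 : ‖(1 / 2 : ℂ)‖ = 1 / 2 := by
      rw [show (1 / 2 : ℂ) = ((1 / 2 : ℝ) : ℂ) by push_cast; ring, Complex.norm_real,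
        Real.norm_eq_abs, abs_of_pos (by positivity)]
    rw [e1, e2]
    linarith [mul_le_mul_of_nonneg_left hR (by norm_num : (0:ℝ) ≤ 1 / 2)]
  have key : π * ‖∑ i ∈ univ.erase i₀, a i‖ ≤ π * (‖h 0‖ / 2 + 2 * K * Real.exp (-γ ^ 2 / (4 * α)) +
      (c₁ * t₁ / 2 + c₂ * Real.exp (κ * T) * T / t₁ +
        c₃ * Real.exp (-α * T ^ 2) / (α * T ^ 2)) / π) := by
    rw [mul_add, mul_add, mul_div_cancel₀ _ Real.pi_pos.ne']
    linarith
  exact le_of_mul_le_mul_left key Real.pi_pos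

end Literature.MathematicalPhysics.QuantumLattice
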